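import Mathlib
import HarnessLib.Audit
import Summits.PneNP.PneNP.Theorems.PstarNoFreeVertex

/-!
# NO HANGING FOREST: the skeleton of a terminal core has no tree component spanned by no clean chord (ROUND-24, O1; all core sizes)

FRONTIER range-avoidance ladder, rung F-N3, ROUND 24 (cell `pnp-ideate`, prover-2 memo `g24/O1-NOFREEVERTEX-g24.md` §32; typed targets
`PstarCoreBoundTargets.TerminalFive` / `TerminalPeelable` (p646951); restricted-model proof complexity — nothing here bears on `P` versus `NP`).

Generalises `PstarNoFreeVertex.false_of_freeVertex` from a single vertex to a HANGING FOREST.  For a family `K` with menu `M`, a pair `(W, T)` of a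
non-empty vertex set `W ⊆ xverts K` and a member set `T ⊆ K` is HANGING when: every member of `T` has both XOR endpoints in `W`; `T` is an
X-FOREST (every non-empty subfamily has a vertex of slot-degree one); and every member of `K ∖ T` with an XOR endpoint in `W` is an
OUTSIDE-GATED CHORD of `K` with its other endpoint outside `W` (an EXIT).  Graph-theoretically: `W` is a union of vertex sets of connected
components of the skeleton `Sk = {members that are not outside-gated chords}`, and the members of `K` spanned by `W` form a forest.  The free vertex
is `W = {u}, T = ∅`; an isolated skeleton member `o` (both endpoints otherwise met by clean chords only) is `W = xpair o, T = {o}`.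

* **`false_of_hanging`** — a terminal core `(K; d₁, d₂)` has NO hanging forest for the menu `d₁.G ∪ d₂.G`.  ALL core sizes, no genericity
  hypothesis, no census.  Proof (strong induction on `#K`): every exit `e` is slice-generic by the criterion for the internal menu
  (`PstarSliceGenericCriterion.sliceGeneric_of_criterion`, `PstarSliceGenericInternal.sliceGeneric_of_internal`): in branch (B) a coincidence
  `F₁` meets `W` only in members of `T` (exits are excluded), so `e + F₁` has odd total slot-degree on `W` — PARITY (`false_of_even_on`); in branch
  (A) a fold through `W` outside `T` is a clean fold (`PstarSkeletalSubcores.false_of_clean_fold`); if the sub-core `K₁` meets `W` then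
  `(W ∩ xverts K₁, T ∩ K₁)` is hanging in `K₁` (`PstarSkeletalSubcores.outsideGated_sub_of_clean`) — induction; otherwise all of `W` is even in
  `e + F₁` — parity again.  An X-forest has two leaves (`two_leaves`), giving two distinct generic exits, and `PstarChordReadTwoClean.false_of_two_clean`
  ends it.
* `false_of_isolated_member` — no member of a terminal core has both XOR endpoints met otherwise by outside-gated chords only (e.g. a FREE
  PARTNER of a centre triangle); `hanging_of_freeVertex` recovers the free vertex.
* CENSUS CONSEQUENCE (planner p3, `r26/`): a centre structure with clean/dirty chord split `(𝒞, 𝒟)` is excluded unless EVERY connected component `C`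
  of `nonchords ∪ 𝒟` (isolated vertices included) spans at least `#C` members of `J₀`; with `#𝒟 ≤ t` this kills every structure of the
  `k ≤ 13` tri/c4a censuses and of the `k = 14` c4a census (prover-2 g24 check `tools/hanging.py`: 1705 + 95 + 24 398 + 1 172 + 11 666 structures,
  0 survivors), with no semantic test at all.
* `CleanAnchoredCriterionBound` (OPEN, census-type): `PstarNoFreeVertex.CleanCoveredCriterionBound` further restricted to ANCHORED structures (no
  hanging forest for the full menu); `cleanCoveredCriterionBound_of_anchored` and
  **`terminalFive_of_anchoredBound : TerminalFiveA → CleanAnchoredCriterionBound → TerminalFive`** (+ `terminalPeelable_of_anchoredBound`).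
-/

set_option linter.dupNamespace false -- `Summit.PneNP.PneNP.…`: summit = sub-problem name (D-0017 single-conjunct layout)

open Finset Literature.Computability.Complexity
open Summit.PneNP.PneNP.Theorems.PstarTyped (Typed)
open Summit.PneNP.PneNP.Theorems.PstarSALevel (varSet bdry BoundaryExpanding SimpleOverlap)
open Summit.PneNP.PneNP.Theorems.PstarXCore (xpair mem_xpair xverts)
open Summit.PneNP.PneNP.Theorems.PstarXorElimination (pdeg)
open Summit.PneNP.PneNP.Theorems.PstarCoreBound (XorClosed)
open Summit.PneNP.PneNP.Theorems.PstarChordRepair (IsChord)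
open Summit.PneNP.PneNP.Theorems.PstarCoreBoundTargets (Terminal TerminalFive TerminalFiveA TerminalPeelable terminalPeelable_of_terminalFive)
open Summit.PneNP.PneNP.Theorems.PstarSharingBound (sharedSlots)
open Summit.PneNP.PneNP.Theorems.PstarChordBridgeTools (xpdeg sum_pair_eq_sum_pdeg)
open Summit.PneNP.PneNP.Theorems.PstarChordBridgeFundamental (xpdeg_insert)
open Summit.PneNP.PneNP.Theorems.PstarChordBridgeExchange (mem_xverts_iff)
open Summit.PneNP.PneNP.Theorems.PstarChordBridgeCotree (exists_leaf_edge)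
open Summit.PneNP.PneNP.Theorems.PstarNorUnitAssembly (xpdeg_empty)
open Summit.PneNP.PneNP.Theorems.PstarNorUnitCoverTools (two_le_xpdeg_of_xorClosed exists_ne_of_two_le_xpdeg)
open Summit.PneNP.PneNP.Theorems.PstarChordReadOutside (OutsideGated)
open Summit.PneNP.PneNP.Theorems.PstarChordReadLemma (SliceGeneric)
open Summit.PneNP.PneNP.Theorems.PstarChordReadTwoClean (false_of_two_clean)
open Summit.PneNP.PneNP.Theorems.PstarSliceGenericCriterion (NoPathSumSubcore NoShortCoincidence sliceGeneric_of_criterion)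
open Summit.PneNP.PneNP.Theorems.PstarSliceGenericInternal (internalMenu internalMenu_subset sliceGeneric_of_internal)
open Summit.PneNP.PneNP.Theorems.PstarSkeletalSubcores (NoSkeletalPathSumSubcore false_of_clean_fold outsideGated_sub_of_clean)
open Summit.PneNP.PneNP.Theorems.PstarNoFreeVertex (FreeVertex Covered CleanCoveredCriterionBound outsideGated_anti vars_mem_xpair
  mem_xpair_of_mem_varSet terminalFive_of_coveredBound)

namespace Summit.PneNP.PneNP.Theorems.PstarHangingForest

variable {n m : ℕ}

/-- **X-FOREST**: every non-empty subfamily of `T` has a vertex of XOR slot-degree exactly one (no leafless part: the XOR graph of `T` is a forest). -/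
def XForest (I : LocalMap 4 n m) (T : Finset (Fin m)) : Prop :=
  ∀ S ⊆ T, S.Nonempty → ∃ w, xpdeg I S w = 1

/-- **HANGING FOREST** `(W, T)` in the family `K` for the menu `M`: `W ≠ ∅` a set of XOR vertices of `K`, `T ⊆ K` with both endpoints of every
member in `W`, `T` an X-forest, and every member of `K ∖ T` with an XOR endpoint in `W` an outside-gated chord of `K` whose other endpoint is not
in `W`. -/
def Hanging (I : LocalMap 4 n m) (K M : Finset (Fin m)) (W : Finset (Fin n)) (T : Finset (Fin m)) : Prop :=
  W.Nonempty ∧ W ⊆ xverts I K ∧ T ⊆ K ∧ (∀ f ∈ T, I.vars f 0 ∈ W ∧ I.vars f 1 ∈ W) ∧ XForest I T ∧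
    ∀ f ∈ K, f ∉ T → (I.vars f 0 ∈ W ∨ I.vars f 1 ∈ W) →
      IsChord I K f ∧ OutsideGated I K M f ∧ ¬ (I.vars f 0 ∈ W ∧ I.vars f 1 ∈ W)

variable {I : LocalMap 4 n m} {r : ℕ} {y : Fin m → Bool}

/-! ## Parity: a set of members closed on `W` plus one exit cannot be even on `W` -/

/-- **PARITY.**  If every member of `F` meeting `W` has both XOR endpoints in `W`, and `e ∉ F` has exactly one XOR endpoint in `W`, then some
vertex of `W` has odd slot-degree in `e + F`. -/
theorem false_of_even_on (I : LocalMap 4 n m) {W : Finset (Fin n)} {F : Finset (Fin m)} {e : Fin m} (heF : e ∉ F)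
    (hone : (I.vars e 0 ∈ W ∧ I.vars e 1 ∉ W) ∨ (I.vars e 0 ∉ W ∧ I.vars e 1 ∈ W))
    (hF : ∀ f ∈ F, (I.vars f 0 ∈ W ∨ I.vars f 1 ∈ W) → I.vars f 0 ∈ W ∧ I.vars f 1 ∈ W)
    (heven : ∀ w ∈ W, Even (xpdeg I (insert e F) w)) : False := by
  classical
  set x : Fin n → ZMod 2 := fun w => if w ∈ W then 1 else 0 with hx
  have h := sum_pair_eq_sum_pdeg (fun j => I.vars j 0) (fun j => I.vars j 1) (insert e F) x
  have hR : ∑ w, (pdeg (fun j => I.vars j 0) (fun j => I.vars j 1) (insert e F) w : ZMod 2) * x w = 0 := by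
    refine sum_eq_zero fun w _ => ?_
    by_cases hw : w ∈ W
    · rw [(ZMod.natCast_eq_zero_iff_even).2 (heven w hw), zero_mul]
    · rw [hx]
      simp only [hw, if_false, mul_zero]
  have hF0 : ∑ j ∈ F, (x (I.vars j 0) + x (I.vars j 1)) = 0 := by
    refine sum_eq_zero fun f hf => ?_
    by_cases htouch : I.vars f 0 ∈ W ∨ I.vars f 1 ∈ W
    · obtain ⟨h0, h1⟩ := hF f hf htouch
      rw [hx]
      simp only [h0, h1, if_true]
      decide
    · push Not at htouch
      rw [hx]
      simp only [htouch.1, htouch.2, if_false, add_zero]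
  rw [sum_insert heF, hR, hF0, add_zero, hx] at h
  rcases hone with ⟨h0, h1⟩ | ⟨h0, h1⟩
  · simp only [h0, h1, if_true, if_false, add_zero] at h
    exact one_ne_zero h
  · simp only [h0, h1, if_true, if_false, zero_add] at h
    exact one_ne_zero h

/-! ## An X-forest has two leaves -/

/-- **TWO LEAVES**: a non-empty X-forest has two distinct vertices of slot-degree one. -/
theorem two_leaves (hI : I.IsPure xorAndPred) :
    ∀ T : Finset (Fin m), T.Nonempty → XForest I T → ∃ w w', w ≠ w' ∧ xpdeg I T w = 1 ∧ xpdeg I T w' = 1 := by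
  classical
  suffices H : ∀ (k : ℕ) (T : Finset (Fin m)), T.card = k → T.Nonempty → XForest I T →
      ∃ w w', w ≠ w' ∧ xpdeg I T w = 1 ∧ xpdeg I T w' = 1 from fun T => H _ T rfl
  intro k
  induction k using Nat.strong_induction_on with
  | _ k ih =>
    intro T hk hne hFA
    obtain ⟨w, hw⟩ := hFA T Subset.rfl hne
    obtain ⟨o, ho, hwo, -⟩ := exists_leaf_edge I hw
    have h01 : I.vars o 0 ≠ I.vars o 1 := fun h => absurd (hI.2 o h) (by decide)
    have hoS : o ∉ T.erase o := notMem_erase o T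
    have hdeg : ∀ v, xpdeg I T v =
        xpdeg I (T.erase o) v + (if I.vars o 0 = v then 1 else 0) + (if I.vars o 1 = v then 1 else 0) := by
      intro v
      conv_lhs => rw [← insert_erase ho]
      exact xpdeg_insert I hoS v
    have hSw : xpdeg I (T.erase o) w = 0 := by
      have h := hdeg w
      rw [hw] at h
      rcases (mem_xpair I).1 hwo with e | e
      · rw [if_pos e.symm] at h
        split_ifs at h <;> omega
      · rw [if_pos e.symm] at h
        split_ifs at h <;> omega
    rcases (T.erase o).eq_empty_or_nonempty with hSe | hSne
    · refine ⟨I.vars o 0, I.vars o 1, h01, ?_, ?_⟩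
      · rw [hdeg, hSe, xpdeg_empty, if_pos rfl, if_neg (Ne.symm h01)]
      · rw [hdeg, hSe, xpdeg_empty, if_neg h01, if_pos rfl]
    · have hlt : (T.erase o).card < k := by rw [← hk]; exact card_erase_lt_of_mem ho
      obtain ⟨a, b, hab, ha, hb⟩ := ih _ hlt (T.erase o) rfl hSne
        fun S hS hSne' => hFA S (hS.trans (erase_subset o T)) hSne'
      have haw : a ≠ w := by
        rintro rfl
        rw [hSw] at ha
        exact absurd ha (by decide)
      have hbw : b ≠ w := by
        rintro rfl
        rw [hSw] at hb
        exact absurd hb (by decide)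
      by_cases haO : I.vars o 0 ≠ a ∧ I.vars o 1 ≠ a
      · exact ⟨w, a, Ne.symm haw, hw, by rw [hdeg, ha, if_neg haO.1, if_neg haO.2]⟩
      · by_cases hbO : I.vars o 0 ≠ b ∧ I.vars o 1 ≠ b
        · exact ⟨w, b, Ne.symm hbw, hw, by rw [hdeg, hb, if_neg hbO.1, if_neg hbO.2]⟩
        · exfalso
          rw [not_and_or, not_not, not_not] at haO hbO
          rcases (mem_xpair I).1 hwo with hw0 | hw1
          · rcases haO with ha0 | ha1
            · exact haw (ha0.symm.trans hw0.symm)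
            · rcases hbO with hb0 | hb1
              · exact hbw (hb0.symm.trans hw0.symm)
              · exact hab (ha1.symm.trans hb1)
          · rcases haO with ha0 | ha1
            · rcases hbO with hb0 | hb1
              · exact hab (ha0.symm.trans hb0)
              · exact hbw (hb1.symm.trans hw1.symm)
            · exact haw (ha1.symm.trans hw1.symm)

/-! ## The theorem -/

/-- **NO HANGING FOREST.**  A terminal core `(K; d₁, d₂)` of a pure typed `(r,3/2)`-expanding instance with simple overlaps admits no hanging
forest for the menu `d₁.G ∪ d₂.G`.  All core sizes. -/
theorem false_of_hanging (hI : I.IsPure xorAndPred) (hT : Typed I) (hS : SimpleOverlap I) (hB : BoundaryExpanding r I)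
    {K : Finset (Fin m)} {d₁ d₂ : Finset (Fin n) × Finset (Fin m) × Bool} (ht : Terminal I r y K d₁ d₂) {W : Finset (Fin n)}
    {T : Finset (Fin m)} (hH : Hanging I K (d₁.2.1 ∪ d₂.2.1) W T) : False := by
  classical
  suffices H : ∀ (k : ℕ) (K : Finset (Fin m)) (d₁ d₂ : Finset (Fin n) × Finset (Fin m) × Bool) (W : Finset (Fin n)) (T : Finset (Fin m)),
      K.card = k → Terminal I r y K d₁ d₂ → Hanging I K (d₁.2.1 ∪ d₂.2.1) W T → False from H _ K d₁ d₂ W T rfl ht hH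
  intro k
  induction k using Nat.strong_induction_on with
  | _ k ih =>
    intro K d₁ d₂ W T hk ht hH
    obtain ⟨hWne, hWx, hTK, hTW, hFA, hexit⟩ := hH
    have hX : XorClosed I K := ht.2.1
    have hKr : K.card < r := ht.2.2.1
    have hdisj : Disjoint K (d₁.2.1 ∪ d₂.2.1) := disjoint_union_right.2 ⟨ht.2.2.2.1, ht.2.2.2.2.1⟩
    have hr : (K ∪ (d₁.2.1 ∪ d₂.2.1)).card ≤ r := by rw [← union_assoc]; exact ht.2.2.2.2.2.1
    have hM' : internalMenu I K (d₁.2.1 ∪ d₂.2.1) ⊆ d₁.2.1 ∪ d₂.2.1 := internalMenu_subset I K _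
    have touch_of_mem : ∀ {f : Fin m} {v : Fin n}, v ∈ xpair I f → v ∈ W → I.vars f 0 ∈ W ∨ I.vars f 1 ∈ W := by
      intro f v hv hvW
      rcases (mem_xpair I).1 hv with e | e
      · exact Or.inl (e ▸ hvW)
      · exact Or.inr (e ▸ hvW)
    -- every exit is slice-generic
    have hgen : ∀ e ∈ K, e ∉ T → (I.vars e 0 ∈ W ∨ I.vars e 1 ∈ W) → SliceGeneric I y K e (d₁.2.1 ∪ d₂.2.1) := by
      intro e he heT htouch
      obtain ⟨hch, hO, hnot⟩ := hexit e he heT htouch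
      have hone : (I.vars e 0 ∈ W ∧ I.vars e 1 ∉ W) ∨ (I.vars e 0 ∉ W ∧ I.vars e 1 ∈ W) := by
        rcases htouch with h0 | h1
        · exact Or.inl ⟨h0, fun h1 => hnot ⟨h0, h1⟩⟩
        · exact Or.inr ⟨fun h0 => hnot ⟨h0, h1⟩, h1⟩
      -- branch (B): parity
      have hBe : NoShortCoincidence I K e (internalMenu I K (d₁.2.1 ∪ d₂.2.1)) := by
        intro F hF _ hnoclean heven _ _
        have heF : e ∉ F := fun h => (mem_erase.1 (hF h)).1 rfl
        refine false_of_even_on I heF hone (fun f hf hfW => ?_) fun w _ => heven w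
        by_contra hboth
        have hfT : f ∉ T := fun hfT => hboth (hTW f hfT)
        obtain ⟨hchf, hOf, -⟩ := hexit f (mem_of_mem_erase (hF hf)) hfT hfW
        exact hnoclean f hf hchf (outsideGated_anti hM' hOf)
      -- branch (A): clean fold, or induction, or parity
      have hAe : NoPathSumSubcore I r y K e (internalMenu I K (d₁.2.1 ∪ d₂.2.1)) := by
        intro K₁ hK₁ _ _ F F' t d₁' d₂' hF hF' hm₁ hm₂ hlin hread _ ht₁
        have heF : e ∉ F := fun h => (mem_erase.1 (mem_sdiff.1 (hF h)).1).1 rfl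
        have hK₁K : K₁ ⊆ K := hK₁.trans (erase_subset e K)
        have hsd : (K.erase e) \ K₁ ⊆ K \ K₁ := sdiff_subset_sdiff (erase_subset e K) (Subset.refl _)
        have hmono : d₁'.2.1 ∪ d₂'.2.1 ⊆ internalMenu I K (d₁.2.1 ∪ d₂.2.1) ∪ (K \ K₁) := by
          refine union_subset ?_ (hm₂.trans (union_subset_union (Subset.refl _) (hF'.trans hsd)))
          rw [hm₁]
          exact (hF.trans hsd).trans subset_union_right
        by_cases hcf : ∃ f ∈ F, f ∉ T ∧ (I.vars f 0 ∈ W ∨ I.vars f 1 ∈ W)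
        · -- a fold meeting `W` outside `T` is an outside-gated chord: clean fold
          obtain ⟨f, hf, hfT, hfW⟩ := hcf
          have hfK : f ∈ K := mem_of_mem_erase (mem_sdiff.1 (hF hf)).1
          obtain ⟨hchf, hOf, -⟩ := hexit f hfK hfT hfW
          have hfm : f ∈ d₁'.2.1 ∪ d₂'.2.1 := mem_union_left _ (by rw [hm₁]; exact hf)
          exact false_of_clean_fold hI hT hS hB ht₁ hK₁K hdisj hmono hfm hfK hchf hOf
        · push Not at hcf
          by_cases hW₁ : (W ∩ xverts I K₁).Nonempty
          · -- the sub-core meets `W`: it carries the hanging forest `(W ∩ xverts K₁, T ∩ K₁)`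
            have hH₁ : Hanging I K₁ (d₁'.2.1 ∪ d₂'.2.1) (W ∩ xverts I K₁) (T ∩ K₁) := by
              refine ⟨hW₁, inter_subset_right, inter_subset_right, fun f hf => ?_, ?_, fun f hfK₁ hfT₁ hfW₁ => ?_⟩
              · obtain ⟨hfT, hfK₁⟩ := mem_inter.1 hf
                obtain ⟨h0, h1⟩ := hTW f hfT
                exact ⟨mem_inter.2 ⟨h0, (mem_xverts_iff I K₁ _).2 ⟨f, hfK₁, vars_mem_xpair f (s := 0) (by decide)⟩⟩,
                  mem_inter.2 ⟨h1, (mem_xverts_iff I K₁ _).2 ⟨f, hfK₁, vars_mem_xpair f (s := 1) (by decide)⟩⟩⟩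
              · exact fun S hS' hSne => hFA S (hS'.trans inter_subset_left) hSne
              · have hfT : f ∉ T := fun h => hfT₁ (mem_inter.2 ⟨h, hfK₁⟩)
                have hfW : I.vars f 0 ∈ W ∨ I.vars f 1 ∈ W :=
                  hfW₁.imp (fun h => (mem_inter.1 h).1) (fun h => (mem_inter.1 h).1)
                obtain ⟨hchf, hOf, hnotf⟩ := hexit f (hK₁K hfK₁) hfT hfW
                obtain ⟨hch₁, hO₁⟩ := outsideGated_sub_of_clean hK₁K hmono hfK₁ hchf hOf
                exact ⟨hch₁, hO₁, fun hb => hnotf ⟨(mem_inter.1 hb.1).1, (mem_inter.1 hb.2).1⟩⟩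
            have hlt : K₁.card < k := by
              rw [← hk]
              exact lt_of_le_of_lt (card_le_card hK₁) (card_erase_lt_of_mem he)
            exact ih K₁.card hlt K₁ d₁' d₂' _ _ rfl ht₁ hH₁
          · -- the sub-core misses `W`: all of `W` is even in `e + F`
            have hWeven : ∀ w ∈ W, Even (xpdeg I (insert e F) w) := by
              intro w hw
              by_contra hodd
              rw [Nat.not_even_iff_odd] at hodd
              obtain ⟨g, hg, hwg⟩ := hread w ((hlin w).2 hodd)
              obtain ⟨f₀, -, hwf₀⟩ := (mem_xverts_iff I K w).1 (hWx hw)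
              obtain ⟨s₀, hs₀, hs₀w⟩ : ∃ s₀ : Fin 4, s₀.val < 2 ∧ I.vars f₀ s₀ = w := by
                rcases (mem_xpair I).1 hwf₀ with e' | e'
                · exact ⟨0, by decide, e'.symm⟩
                · exact ⟨1, by decide, e'.symm⟩
              subst hs₀w
              exact hW₁ ⟨_, mem_inter.2 ⟨hw, (mem_xverts_iff I K₁ _).2 ⟨g, hg, mem_xpair_of_mem_varSet hT hs₀ hwg⟩⟩⟩
            refine false_of_even_on I heF hone (fun f hf hfW => ?_) hWeven
            by_contra hboth
            have hfT : f ∉ T := fun hfT => hboth (hTW f hfT)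
            obtain ⟨h0, h1⟩ := hcf f hf hfT
            rcases hfW with h | h
            exacts [h0 h, h1 h]
      have hdisj' : Disjoint K (internalMenu I K (d₁.2.1 ∪ d₂.2.1)) := hdisj.mono_right hM'
      have hr' : (K ∪ internalMenu I K (d₁.2.1 ∪ d₂.2.1)).card ≤ r :=
        (card_le_card (union_subset_union (Subset.refl _) hM')).trans hr
      exact sliceGeneric_of_internal hI hT hS hB hKr.le he hch hO (sliceGeneric_of_criterion hI hT hS hB he hdisj' hr' hAe hBe)
    -- two distinct exits
    obtain ⟨e₁, he₁, he₁T, he₁W, e₂, he₂, he₂T, he₂W, hne⟩ : ∃ e₁ ∈ K, e₁ ∉ T ∧ (I.vars e₁ 0 ∈ W ∨ I.vars e₁ 1 ∈ W) ∧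
        ∃ e₂ ∈ K, e₂ ∉ T ∧ (I.vars e₂ 0 ∈ W ∨ I.vars e₂ 1 ∈ W) ∧ e₁ ≠ e₂ := by
      rcases T.eq_empty_or_nonempty with hT0 | hTne
      · -- empty forest: a vertex of `W` with two members through it
        subst hT0
        obtain ⟨w, hw⟩ := hWne
        obtain ⟨f₀, hf₀, hwf₀⟩ := (mem_xverts_iff I K w).1 (hWx hw)
        obtain ⟨f₁, hf₁, hne, hwf₁⟩ := exists_ne_of_two_le_xpdeg I hI f₀ (two_le_xpdeg_of_xorClosed I hT hX w (hWx hw))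
        exact ⟨f₀, hf₀, notMem_empty _, touch_of_mem hwf₀ hw, f₁, hf₁, notMem_empty _, touch_of_mem hwf₁ hw, hne.symm⟩
      · obtain ⟨w, w', hww', hw, hw'⟩ := two_leaves hI T hTne hFA
        -- an exit at each leaf
        have hex : ∀ v, xpdeg I T v = 1 → ∃ e ∈ K, e ∉ T ∧ v ∈ xpair I e ∧ v ∈ W := by
          intro v hv
          obtain ⟨o, ho, hvo, huniq⟩ := exists_leaf_edge I hv
          have hvW : v ∈ W := by
            rcases (mem_xpair I).1 hvo with e' | e'
            · rw [e']; exact (hTW o ho).1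
            · rw [e']; exact (hTW o ho).2
          have hvx : v ∈ xverts I K := (mem_xverts_iff I K v).2 ⟨o, hTK ho, hvo⟩
          obtain ⟨e, he, hne, hve⟩ := exists_ne_of_two_le_xpdeg I hI o (two_le_xpdeg_of_xorClosed I hT hX v hvx)
          exact ⟨e, he, fun heT => hne (huniq e heT hve), hve, hvW⟩
        obtain ⟨e₁, he₁, he₁T, hwe₁, hwW⟩ := hex w hw
        obtain ⟨e₂, he₂, he₂T, hwe₂, hw'W⟩ := hex w' hw'
        have hne : e₁ ≠ e₂ := by
          rintro rfl
          obtain ⟨-, -, hnot⟩ := hexit e₁ he₁ he₁T (touch_of_mem hwe₁ hwW)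
          apply hnot
          rcases (mem_xpair I).1 hwe₁ with h0 | h1 <;> rcases (mem_xpair I).1 hwe₂ with h0' | h1'
          · exact absurd (h0.trans h0'.symm) hww'
          · exact ⟨h0 ▸ hwW, h1' ▸ hw'W⟩
          · exact ⟨h0' ▸ hw'W, h1 ▸ hwW⟩
          · exact absurd (h1.trans h1'.symm) hww'
        exact ⟨e₁, he₁, he₁T, touch_of_mem hwe₁ hwW, e₂, he₂, he₂T, touch_of_mem hwe₂ hw'W, hne⟩
    obtain ⟨hch₁, hO₁, -⟩ := hexit e₁ he₁ he₁T he₁W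
    obtain ⟨hch₂, hO₂, -⟩ := hexit e₂ he₂ he₂T he₂W
    exact false_of_two_clean hI hT hS hB ht he₁ he₂ hne hch₁ hch₂ hO₁ hO₂ (hgen e₁ he₁ he₁T he₁W) (hgen e₂ he₂ he₂T he₂W)

/-! ## Special cases -/
section Special

variable {K : Finset (Fin m)} {d₁ d₂ : Finset (Fin n) × Finset (Fin m) × Bool}

/-- A free vertex is a hanging forest with no members (`PstarNoFreeVertex.false_of_freeVertex` is the case `W = {u}`, `T = ∅`). -/
theorem hanging_of_freeVertex (hI : I.IsPure xorAndPred) {M : Finset (Fin m)} {u : Fin n} (h : FreeVertex I K M u) :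
    Hanging I K M {u} ∅ := by
  obtain ⟨⟨f₀, hf₀, huf₀⟩, hfree⟩ := h
  refine ⟨⟨u, mem_singleton_self u⟩, fun v hv => ?_, empty_subset K, fun f hf => absurd hf (notMem_empty f),
    fun S hS hne => ?_, fun f hf _ htouch => ?_⟩
  · rw [mem_singleton.1 hv]
    exact (mem_xverts_iff I K u).2 ⟨f₀, hf₀, huf₀⟩
  · exact absurd (subset_empty.1 hS) hne.ne_empty
  · have hu : u ∈ varSet I f := by
      rcases htouch with h | h
      · rw [← mem_singleton.1 h]; exact PstarCentreFree.vars_mem_varSet I f 0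
      · rw [← mem_singleton.1 h]; exact PstarCentreFree.vars_mem_varSet I f 1
    obtain ⟨hch, hO⟩ := hfree f hf hu
    refine ⟨hch, hO, fun hb => ?_⟩
    have h01 : I.vars f 0 ≠ I.vars f 1 := fun h => absurd (hI.2 f h) (by decide)
    exact h01 ((mem_singleton.1 hb.1).trans (mem_singleton.1 hb.2).symm)

/-- **NO ISOLATED SKELETON MEMBER.**  No member `o` of a terminal core has both XOR endpoints met, apart from `o` itself, only by outside-gated
chords (e.g. a FREE PARTNER of a centre triangle: a non-chord sharing an AND variable with a triangle edge, whose two XOR endpoints carry only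
clean chords besides).  The case `W = xpair o`, `T = {o}`; a second member inside `xpair o` would be parallel to `o` (simple overlaps). -/
theorem false_of_isolated_member (hI : I.IsPure xorAndPred) (hT : Typed I) (hS : SimpleOverlap I) (hB : BoundaryExpanding r I)
    (ht : Terminal I r y K d₁ d₂) {o : Fin m} (ho : o ∈ K)
    (hiso : ∀ f ∈ K, f ≠ o → (I.vars f 0 ∈ xpair I o ∨ I.vars f 1 ∈ xpair I o) →
      IsChord I K f ∧ OutsideGated I K (d₁.2.1 ∪ d₂.2.1) f) : False := by
  refine false_of_hanging hI hT hS hB ht (W := xpair I o) (T := {o})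
    ⟨⟨I.vars o 0, vars_mem_xpair o (s := 0) (by decide)⟩, fun v hv => (mem_xverts_iff I K v).2 ⟨o, ho, hv⟩, singleton_subset_iff.2 ho,
      fun f hf => ?_, fun S hS hne => ?_, fun f hf hfo htouch => ?_⟩
  · rw [mem_singleton.1 hf]
    exact ⟨vars_mem_xpair o (s := 0) (by decide), vars_mem_xpair o (s := 1) (by decide)⟩
  · have hSo : S = {o} := subset_singleton_iff'.1 hS |> fun h => eq_singleton_iff_nonempty_unique_mem.2 ⟨hne, h⟩
    rw [hSo]
    exact ⟨I.vars o 0, PstarNorUnitAssembly.xpdeg_singleton_of_mem I hI (vars_mem_xpair o (s := 0) (by decide))⟩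
  · have hne : f ≠ o := fun h => hfo (mem_singleton.2 h)
    obtain ⟨hch, hO⟩ := hiso f hf hne htouch
    exact ⟨hch, hO, fun hb => PstarChordBridgeFundamental.false_of_both_ends I hI hS hne.symm hb.1 hb.2⟩

end Special

/-! ## The census node restricted to anchored structures, and the core bound from it -/

/-- **ANCHORED**: the family `J₀` admits no hanging forest for the menu `𝒢` (every union of components of its skeleton spans a cycle). -/
def Anchored (I : LocalMap 4 n m) (J₀ 𝒢 : Finset (Fin m)) : Prop := ∀ W T, ¬ Hanging I J₀ 𝒢 W T

/-- **Terminal cores are anchored.** -/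
theorem anchored_of_terminal (hI : I.IsPure xorAndPred) (hT : Typed I) (hS : SimpleOverlap I) (hB : BoundaryExpanding r I)
    {J₀ : Finset (Fin m)} {w₁ w₂ : Finset (Fin n) × Finset (Fin m) × Bool} (ht : Terminal I r y J₀ w₁ w₂) :
    Anchored I J₀ (w₁.2.1 ∪ w₂.2.1) :=
  fun _ _ hH => false_of_hanging hI hT hS hB ht hH

/-- **`CleanAnchoredCriterionBound` (OPEN, census-type)**: `PstarNoFreeVertex.CleanCoveredCriterionBound` with the further hypothesis that the
terminal core is `Anchored` (no hanging forest for the full menu).  By `anchored_of_terminal` the hypothesis costs nothing; it empties the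
`k ≤ 13` tri/c4a and `k = 14` c4a centre-structure censuses.  FRONTIER. -/
@[conjecture] def CleanAnchoredCriterionBound : Prop :=
  ∀ (n m r : ℕ) (I : LocalMap 4 n m), I.IsPure xorAndPred → Typed I → SimpleOverlap I → BoundaryExpanding r I →
    ∀ (y : Fin m → Bool) (J₀ : Finset (Fin m)) (w₁ w₂ : Finset (Fin n) × Finset (Fin m) × Bool), Terminal I r y J₀ w₁ w₂ →
      (∃ S ⊆ J₀, S.Nonempty ∧ (∀ w ∈ xverts I S, 2 ≤ xpdeg I S w) ∧ ∀ f ∈ S, ¬ IsChord I J₀ f) →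
      Covered I J₀ (w₁.2.1 ∪ w₂.2.1) → Anchored I J₀ (w₁.2.1 ∪ w₂.2.1) →
      ∃ ℬ ⊆ J₀, ℬ.card + 2 ≤ (sharedSlots I J₀).card ∧
        ∀ c ∈ J₀, c ∉ ℬ → IsChord I J₀ c → OutsideGated I J₀ (w₁.2.1 ∪ w₂.2.1) c →
          NoSkeletalPathSumSubcore I r y J₀ c (w₁.2.1 ∪ w₂.2.1) ∧ NoShortCoincidence I J₀ c (internalMenu I J₀ (w₁.2.1 ∪ w₂.2.1))

/-- The anchored bound gives the covered bound (terminal cores are anchored). -/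
theorem cleanCoveredCriterionBound_of_anchored (h : CleanAnchoredCriterionBound) : CleanCoveredCriterionBound :=
  fun n m r I hI hT hS hB y J₀ w₁ w₂ ht hS₀ hcov => h n m r I hI hT hS hB y J₀ w₁ w₂ ht hS₀ hcov (anchored_of_terminal hI hT hS hB ht)

/-- **THE CORE BOUND FROM O2 AND THE ANCHORED CRITERION BOUND.** -/
theorem terminalFive_of_anchoredBound (hO2 : TerminalFiveA) (hb : CleanAnchoredCriterionBound) : TerminalFive :=
  terminalFive_of_coveredBound hO2 (cleanCoveredCriterionBound_of_anchored hb)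

/-- **O1 from the same inputs.** -/
theorem terminalPeelable_of_anchoredBound (hO2 : TerminalFiveA) (hb : CleanAnchoredCriterionBound) : TerminalPeelable :=
  terminalPeelable_of_terminalFive (terminalFive_of_anchoredBound hO2 hb)

end Summit.PneNP.PneNP.Theorems.PstarHangingForest
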